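/-
Copyright (c) 2026 the pub-hodgecm-mathlib formalisation cell (harness21).  Prover seat hodgecm-mathlib-K2E1-p16 (g3), Track B «K2-LIT» ENGINE E1, h413 = `stmt-HodgeConjecture-24833`,
route `HCCMUnconditional`, R90-S8 «ContSpec-n½», deal S8-R196 (S8 dealer R90-CS-plan (g3)): THE PAYER OF THE χ POLE LEDGER'S TWO LETTERS (B-P-K) `hbddPK` AND (B-3∕2) `hbdd32`
(★ p863972 `K2E1ChiEisensteinPoleLedgerCMThree`) FROM THE `L²` MAASS–SELBERG BOUNDS OF THE TRUNCATED FAMILY, via the eigen-smoothing domination (★ p863948∕p863984).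
-/
import Summits.HodgeConjecture.HodgeConjecture.Theorems.K2E1EventualL2BoundPointwiseAtLevelCMThree   -- ★ p863948∕p863984 (this seat): (a′) heads; brings ★ `exists_bound_smoothing_truncation_of_isCompact`, ★ `truncation_rational_mul`, ★ `quotientSubgroup_quasiSplit`
import HarnessLib

/-!
# h413 ∕ R90-S8 — `K2E1ChiEisensteinJointBoundOfL2FamilyCMThree`: THE LETTERS (B-P-K) AND (B-3∕2) OF THE χ POLE LEDGER, PAID FROM `L²`-BOUNDS OF `[Λ^T Ẽ_χ(z)]`
# (joint pointwise bound of the continued family near a candidate pole, uniform on compacts; the `(z − 3∕2)`-weighted bound at the middle pole)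

Cell `pub/hodgecm-mathlib`, crux H413 = `stmt-HodgeConjecture-24833`; S8 dealer R90-CS-plan (g3), S8-R196 («FIRST the pole-ledger letters (B-P-K) + (B-3∕2) payer, THEN R7₃»); census on the
R90 bus 2026-09-05T01:16Z.  Consumer: K2E2-p12 (g9)'s ★ p863972 `chiEisenstein_poleLedger_rows_cm_three_of_letters` (letters `hbddPK`, `hbdd32`, bytes :263–:265).  THEOREMS ONLY (no `def`, no
`instance`, no notation, no named-fact hypothesis, no `sorry`; default heartbeats); lane `--supports stmt-HodgeConjecture-24833 --as helper` (count-neutral).  Closes no socket.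

THE MATHEMATICS ([MoeglinWaldspurger1995, IV.3.12]; [BernsteinLapid2019, §4 p. 10]).  On an eventual set `S` of admissible parameters near `z₀` (`S = Pᶜ`, `P` the closed-discrete candidate
pole set) the continued family satisfies the EIGEN-SMOOTHING identity `∫ h(y)·Ẽ(z)(g y) dν_G = s(z)·Ẽ(z)(g)` (★ p863948 §2) with `s(z₀) ≠ 0`, and the rank-generic DOMINATION ★
`exists_bound_smoothing_truncation_of_isCompact` gives, uniformly for `g` in a compact `K` and `T ≥ T₀(K)`: `‖s(z)·Ẽ(z)(g)‖ = ‖∫ h(y)Ẽ(z)(gy)‖ ≤ C₀·‖[Λ^T Ẽ(z)]‖_{L²(μ)}`.  Multiplying by a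
WEIGHT `a(z)` (`a ≡ 1` for (B-P-K); `a(z) = z − 3∕2` for (B-3∕2)) and using `‖s(z)‖ ≥ ‖s(z₀)‖∕2` near `z₀`:
  `‖a(z)·Ẽ(z)(g)‖ ≤ (2∕‖s(z₀)‖)·C₀·sup ‖a(z)‖·‖[Λ^T Ẽ(z)]‖_{L²}`  for all `g ∈ K`, eventually near `z₀`
— so an EVENTUAL `L²`-BOUND of the (weighted) truncated family, the Maass–Selberg letters (MS-P′) ∕ (MS-3∕2), pays the ledger's pointwise letters.  The `L²` currency is `eLpNorm`
(FAMILY-FREE, so the letter can sit outside the `∃ Fam` of (E6) ★ p863930); the dictionary `(eLpNorm f 2 μ).toReal = ‖Fam z‖` for `⇑(Fam z) =ᵐ f` converts the operator-road currency.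
* §1 **`truncation_smul`** (`Λ^T(c•u) = c·Λ^T u`, ★ `borelConstantTerm_smul` + ★ `pseudoEisenstein_smul`), `quotFun_truncation_smul`, **`eLpNorm_toReal_eq_norm_of_ae_eq`**, `norm_mul_eLpNorm_toReal_eq_norm_smul_of_ae_eq` (the dictionaries).
* §2 **`eventually_forall_norm_mul_le_of_smoothing_eLpNorm_cm_three`** — THE ENGINE (weight `a`, compact `K`, eLpNorm currency).
* §3 **`hbddPK_of_letters_cm_three`** — (B-P-K) in ★ p863972's BYTES from {`hPcd`, `hEcinv` off `P`, the per-candidate smoothing letter `hSM`, `hL2` (= (E6)), (MS-P′) `hMSP`};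
  **`hbdd32_of_letters_cm_three`** — (B-3∕2) in ★ p863972's BYTES from the same at `3∕2` with the weighted letter (MS-3∕2) `hMS32`; **`hbddPK_of_L2Family_letters_cm_three`** — (B-P-K)
  with `hL2`∕(MS-P′) read off (E6)-style `L²(μ)`-representatives (`‖Fam z‖`-currency).
WHAT STAYS A LETTER (honest, named): (MS-P′) `hMSP` (eventual `L²`-bound of `[Λ^T Ẽ(z)]` at every candidate pole `z₀ ∈ P`, `1 < Re z₀`, `z₀ ≠ 3∕2`, every level `T ≥ 1` — off-axis: χ pole
exclusion, ★ `normSq_family_eq_chiFourTerm_of_tube` ∘ ★ `poleControl_of_fourTerm`; on-axis: R7₃), (MS-3∕2) `hMS32` (★ `msBound_middlePole_of_tube_letters` chain per level), the smoothing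
letters `hSM`∕`hSM32` (★ exports' `hCD`: `hact` + `hcov`, continued by ★ p863948 §2), `hL2` (★ (E6)).
HONEST LABEL: HC_CM is proved only modulo the 7 printed citations (2 remaining named inputs: hLiu418 = `stmt-HodgeConjecture-24832`, h413 = `stmt-HodgeConjecture-24833`) until rung 0
closes; this file asserts no named fact and closes no socket; its heads are CONDITIONAL on the named letters; count-neutral.

## References
* [MoeglinWaldspurger1995] C. Mœglin, J.-L. Waldspurger, *Spectral Decomposition and Eisenstein Series* (1995), IV.1.9, IV.3.12.
* [BernsteinLapid2019] J. Bernstein, E. Lapid, *On the meromorphic continuation of Eisenstein series*, J. Amer. Math. Soc. 37 (2024), §4 (p. 10).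
* [Garrett2018] P. Garrett, *Modern Analysis of Automorphic Forms by Example* (2018), §1.12, §2.10.
-/

set_option autoImplicit false
-- the mandated namespace repeats the single-problem summit's segment (`HodgeConjecture.HodgeConjecture`)
set_option linter.dupNamespace false

noncomputable section

open MeasureTheory Measure NumberField IsDedekindDomain Set Filter Topology
open scoped ENNReal NNReal
open Literature.NumberTheory.Automorphic Literature.NumberTheory.Automorphic.UnitaryGroup AdelicGroupData
open Summit.HodgeConjecture.HodgeConjecture.Cruxes.H413.K2E1BorelEisensteinU
open Summit.HodgeConjecture.HodgeConjecture.Cruxes.H413.K2E1BLRemovablePolesU (exists_bound_smoothing_truncation_of_isCompact)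

namespace Summit.HodgeConjecture.HodgeConjecture.Cruxes.H413.K2E1ChiEisensteinJointBoundOfL2FamilyCMThree

/-! ## §1 Dictionaries: `Λ^T` is `ℂ`-linear; `eLpNorm` versus the norm of an `L²` representative -/

section Dictionary

variable {F E : Type} [Field F] [NumberField F] [Field E] [NumberField E] [Algebra F E] {c : E ≃ₐ[F] E} {N : ℕ} [NeZero N]
variable [MeasurableSpace (quasiSplit F E c N).Adelic]

/-- **`Λ^T (c • u) = c · Λ^T u`** — Arthur's truncation is homogeneous (★ `borelConstantTerm_smul`, `Set.indicator_const_smul`, ★ `pseudoEisenstein_smul`). [cite: Garrett2018, §2.10] -/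
theorem truncation_smul (ν : Measure ↥(adelicUnipotent F E c N)) (𝓕 : Set ↥(adelicUnipotent F E c N)) (T : ℝ≥0) (a : ℂ)
    (u : (quasiSplit F E c N).Adelic → ℂ) (g : (quasiSplit F E c N).Adelic) :
    truncation ν 𝓕 T (a • u) g = a * truncation ν 𝓕 T u g := by
  have hB : borelConstantTerm ν 𝓕 (a • u) = a • borelConstantTerm ν 𝓕 u :=
    funext fun x => by rw [Pi.smul_apply, smul_eq_mul]; exact borelConstantTerm_smul ν 𝓕 a u x
  have hct : constantTermTail ν 𝓕 T (a • u) = a • constantTermTail ν 𝓕 T u := by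
    funext x
    show Set.indicator {x | T < borelHeight x} (borelConstantTerm ν 𝓕 (a • u)) x = a • Set.indicator {x | T < borelHeight x} (borelConstantTerm ν 𝓕 u) x
    rw [hB]
    by_cases hx : x ∈ {x : (quasiSplit F E c N).Adelic | T < borelHeight x}
    · rw [Set.indicator_of_mem hx, Set.indicator_of_mem hx, Pi.smul_apply]
    · rw [Set.indicator_of_notMem hx, Set.indicator_of_notMem hx, smul_zero]
  rw [truncation_def, truncation_def, hct, pseudoEisenstein_smul, Pi.smul_apply, smul_eq_mul, mul_sub]

/-- `quotFun (Λ^T (a • u)) = a • quotFun (Λ^T u)`. [cite: Garrett2018, §2.10] -/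
theorem quotFun_truncation_smul (ν : Measure ↥(adelicUnipotent F E c N)) (𝓕 : Set ↥(adelicUnipotent F E c N)) (T : ℝ≥0) (a : ℂ)
    (u : (quasiSplit F E c N).Adelic → ℂ) :
    (quasiSplit F E c N).quotFun (truncation ν 𝓕 T (a • u)) = a • (quasiSplit F E c N).quotFun (truncation ν 𝓕 T u) :=
  funext fun _ => truncation_smul ν 𝓕 T a u _

end Dictionary

section LpDictionary

variable {α : Type*} {mα : MeasurableSpace α} {μ : Measure α}

/-- **THE `L²` DICTIONARY**: if `⇑v =ᵐ[μ] f` for `v ∈ L²(μ)` then `(eLpNorm f 2 μ).toReal = ‖v‖` (Mathlib `Lp.norm_def`, `eLpNorm_congr_ae`). [folklore] -/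
theorem eLpNorm_toReal_eq_norm_of_ae_eq {v : Lp ℂ 2 μ} {f : α → ℂ} (h : (v : α → ℂ) =ᵐ[μ] f) : (eLpNorm f 2 μ).toReal = ‖v‖ := by
  rw [eLpNorm_congr_ae h.symm, Lp.norm_def]

/-- The weighted form: `‖a‖ · (eLpNorm f 2 μ).toReal = ‖a • v‖` when `⇑v =ᵐ f` (`norm_smul`). [folklore] -/
theorem norm_mul_eLpNorm_toReal_eq_norm_smul_of_ae_eq {v : Lp ℂ 2 μ} {f : α → ℂ} (h : (v : α → ℂ) =ᵐ[μ] f) (a : ℂ) :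
    ‖a‖ * (eLpNorm f 2 μ).toReal = ‖a • v‖ := by
  rw [eLpNorm_toReal_eq_norm_of_ae_eq h, norm_smul]

end LpDictionary

/-! ## §2 The engine: weighted pointwise bound on a compact from an eventual weighted `L²`-bound of the truncated family -/

section Engine

variable (L : Type) [Field L] [NumberField L] [IsCMField L]
variable [MeasurableSpace (quasiSplit (↥(maximalRealSubfield L)) L (IsCMField.complexConj L) 3).Adelic] [BorelSpace (quasiSplit (↥(maximalRealSubfield L)) L (IsCMField.complexConj L) 3).Adelic]
  (μ : Measure (quasiSplit (↥(maximalRealSubfield L)) L (IsCMField.complexConj L) 3).automorphicQuotient) [(quasiSplit (↥(maximalRealSubfield L)) L (IsCMField.complexConj L) 3).IsAutomorphicMeasure μ]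
  (νG : Measure (quasiSplit (↥(maximalRealSubfield L)) L (IsCMField.complexConj L) 3).Adelic) [νG.IsHaarMeasure] [νG.IsInvInvariant]

/-- **THE ENGINE — WEIGHTED JOINT POINTWISE BOUND FROM A WEIGHTED EVENTUAL `L²`-BOUND.**  Data: `h ∈ C_c(G(𝔸))` real; `s` continuous at `z₀`, `s z₀ ≠ 0`; an eventual admissible set `S`
(`∀ᶠ z in 𝓝[≠] z₀, z ∈ S`) on which `Ec z` is left-`G(F)`-invariant and `∫ h(y)·Ec z (g y) dν_G = s z·Ec z g`; `ν` Haar on `N(𝔸)` with fundamental domain `𝓕`; a weight `a : ℂ → ℂ`; a compact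
`K`.  THEN `∃ T₀, ∀ T ≥ T₀`: if the slices `quotFun (Λ^T(Ec z))` are in `L²(μ)` on `S` and `‖a z‖·‖quotFun (Λ^T(Ec z))‖_{L²(μ)} ≤ C` eventually near `z₀` on `S`, then
**`∃ C′, ∀ᶠ z in 𝓝[≠] z₀, ∀ g ∈ K, ‖a z·Ec z g‖ ≤ C′`** (★ `exists_bound_smoothing_truncation_of_isCompact` on `K`; `‖s z‖ ≥ ‖s z₀‖∕2` near `z₀`).
[cite: MoeglinWaldspurger1995, IV.3.12] [cite: BernsteinLapid2019, §4 p. 10] [cite: Garrett2018, §2.10] -/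
theorem eventually_forall_norm_mul_le_of_smoothing_eLpNorm_cm_three
    (ν : Measure ↥(adelicUnipotent (↥(maximalRealSubfield L)) L (IsCMField.complexConj L) 3)) [ν.IsHaarMeasure]
    {𝓕 : Set ↥(adelicUnipotent (↥(maximalRealSubfield L)) L (IsCMField.complexConj L) 3)}
    (h𝓕N : IsFundamentalDomain ↥(rationalUnipotent (↥(maximalRealSubfield L)) L (IsCMField.complexConj L) 3) 𝓕 ν)
    {h : (quasiSplit (↥(maximalRealSubfield L)) L (IsCMField.complexConj L) 3).Adelic → ℝ} (hhc : Continuous h) (hhs : HasCompactSupport h)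
    {s : ℂ → ℂ} {z₀ : ℂ} (hsc : ContinuousAt s z₀) (hs0 : s z₀ ≠ 0)
    (Ec : ℂ → (quasiSplit (↥(maximalRealSubfield L)) L (IsCMField.complexConj L) 3).Adelic → ℂ) {S : Set ℂ} (hS : ∀ᶠ z in 𝓝[≠] z₀, z ∈ S)
    (hEcinv : ∀ z ∈ S, ∀ (γ : (quasiSplit (↥(maximalRealSubfield L)) L (IsCMField.complexConj L) 3).arithmeticSubgroup) (x : (quasiSplit (↥(maximalRealSubfield L)) L (IsCMField.complexConj L) 3).Adelic),
      Ec z ((γ : (quasiSplit (↥(maximalRealSubfield L)) L (IsCMField.complexConj L) 3).Adelic) * x) = Ec z x)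
    (hsmooth : ∀ z ∈ S, ∀ g : (quasiSplit (↥(maximalRealSubfield L)) L (IsCMField.complexConj L) 3).Adelic, ∫ y, ((h y : ℝ) : ℂ) * Ec z (g * y) ∂νG = s z * Ec z g)
    (a : ℂ → ℂ) {K : Set (quasiSplit (↥(maximalRealSubfield L)) L (IsCMField.complexConj L) 3).Adelic} (hK : IsCompact K) :
    ∃ T₀ : ℝ≥0, ∀ T : ℝ≥0, T₀ ≤ T →
      (∀ z ∈ S, MemLp ((quasiSplit (↥(maximalRealSubfield L)) L (IsCMField.complexConj L) 3).quotFun (truncation ν 𝓕 T (Ec z))) 2 μ) →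
      (∃ C : ℝ, ∀ᶠ z in 𝓝[≠] z₀, z ∈ S → ‖a z‖ * (eLpNorm ((quasiSplit (↥(maximalRealSubfield L)) L (IsCMField.complexConj L) 3).quotFun (truncation ν 𝓕 T (Ec z))) 2 μ).toReal ≤ C) →
      ∃ C : ℝ, ∀ᶠ z in 𝓝[≠] z₀, ∀ g ∈ K, ‖a z * Ec z g‖ ≤ C := by
  obtain ⟨C₀, T₀, hC₀⟩ := exists_bound_smoothing_truncation_of_isCompact μ νG ν 𝓕 hhc hhs hK
  refine ⟨T₀, fun T hT hL2 hMS => ?_⟩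
  obtain ⟨C, hC⟩ := hMS
  have hpos : 0 < ‖s z₀‖ / 2 := by positivity
  have hnear : ∀ᶠ z in 𝓝 z₀, ‖s z₀‖ / 2 ≤ ‖s z‖ := by
    have h1 := hsc.norm.eventually (Ici_mem_nhds (show ‖s z₀‖ / 2 < ‖s z₀‖ by linarith [norm_pos_iff.2 hs0]))
    filter_upwards [h1] with z hz using hz
  refine ⟨max C₀ 0 * max C 0 / (‖s z₀‖ / 2), ?_⟩
  filter_upwards [hS, hC, mem_nhdsWithin_of_mem_nhds hnear] with z hzS hzC hzs g hg
  -- the two inputs of the domination at level `T`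
  have hG : ∀ γ ∈ (quasiSplit (↥(maximalRealSubfield L)) L (IsCMField.complexConj L) 3).quotientSubgroup, ∀ y, truncation ν 𝓕 T (Ec z) (γ * y) = truncation ν 𝓕 T (Ec z) y := by
    intro γ hγ y
    rw [quotientSubgroup_quasiSplit] at hγ
    exact truncation_rational_mul ν h𝓕N T (hEcinv z hzS) ⟨γ, hγ⟩ y
  have hb := hC₀ T hT g hg (Ec z) hG (hL2 z hzS)
  rw [hsmooth z hzS g] at hb
  -- `‖a z‖·‖s z·Ec z g‖ ≤ max C₀ 0 · max C 0`
  have hN0 : 0 ≤ (eLpNorm ((quasiSplit (↥(maximalRealSubfield L)) L (IsCMField.complexConj L) 3).quotFun (truncation ν 𝓕 T (Ec z))) 2 μ).toReal := ENNReal.toReal_nonneg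
  have hB : ‖a z‖ * ‖s z * Ec z g‖ ≤ max C₀ 0 * max C 0 :=
    calc ‖a z‖ * ‖s z * Ec z g‖
        ≤ ‖a z‖ * (max C₀ 0 * (eLpNorm ((quasiSplit (↥(maximalRealSubfield L)) L (IsCMField.complexConj L) 3).quotFun (truncation ν 𝓕 T (Ec z))) 2 μ).toReal) :=
          mul_le_mul_of_nonneg_left (hb.trans (mul_le_mul_of_nonneg_right (le_max_left _ _) hN0)) (norm_nonneg _)
      _ = max C₀ 0 * (‖a z‖ * (eLpNorm ((quasiSplit (↥(maximalRealSubfield L)) L (IsCMField.complexConj L) 3).quotFun (truncation ν 𝓕 T (Ec z))) 2 μ).toReal) := by ring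
      _ ≤ max C₀ 0 * max C 0 := mul_le_mul_of_nonneg_left ((hzC hzS).trans (le_max_left _ _)) (le_max_right _ _)
  rw [le_div_iff₀ hpos]
  calc ‖a z * Ec z g‖ * (‖s z₀‖ / 2) ≤ ‖a z * Ec z g‖ * ‖s z‖ := mul_le_mul_of_nonneg_left hzs (norm_nonneg _)
    _ = ‖a z‖ * ‖s z * Ec z g‖ := by rw [norm_mul, norm_mul]; ring
    _ ≤ max C₀ 0 * max C 0 := hB

end Engine

/-! ## §3 The ledger's letters (B-P-K) and (B-3∕2), in ★ p863972's bytes -/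

section Ledger

variable (L : Type) [Field L] [NumberField L] [IsCMField L]
variable [MeasurableSpace (quasiSplit (↥(maximalRealSubfield L)) L (IsCMField.complexConj L) 3).Adelic] [BorelSpace (quasiSplit (↥(maximalRealSubfield L)) L (IsCMField.complexConj L) 3).Adelic]
  (μ : Measure (quasiSplit (↥(maximalRealSubfield L)) L (IsCMField.complexConj L) 3).automorphicQuotient) [(quasiSplit (↥(maximalRealSubfield L)) L (IsCMField.complexConj L) 3).IsAutomorphicMeasure μ]
  (νG : Measure (quasiSplit (↥(maximalRealSubfield L)) L (IsCMField.complexConj L) 3).Adelic) [νG.IsHaarMeasure] [νG.IsInvInvariant]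

/-- **(B-P-K) OF LETTERS** — the ★ pole ledger's joint letter `hbddPK` (★ p863972 :263) `∀ z₀ ∈ P, 1 < Re z₀ → z₀ ≠ 3∕2 → ∀ K compact, ∃ C, ∀ᶠ z in 𝓝[≠] z₀, ∀ g ∈ K, ‖Ec z g‖ ≤ C`, PAID FROM:
the co-discreteness of the candidate pole set (`hPcd`), left-`G(F)`-invariance of `Ec z` off `P` (`hEcinv`), the per-candidate SMOOTHING LETTER `hSM` (a real `h ∈ C_c` and `s` continuous at
`z₀` with `s z₀ ≠ 0` and `∫ h(y)·Ec z (g y) dν_G = s z·Ec z g` off `P` — ★ exports' `hact`+`hcov` through ★ `integral_mul_continued_eq_of_eigen_cm_three`), square-integrability of the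
truncations off `P` (`hL2`, = (E6) ★ p863930), and THE analytic letter (MS-P′) `hMSP`: an eventual `L²(μ)`-bound of `[Λ^T Ẽ(z)]` at every candidate pole, every level `T ≥ 1`.  §2 with `a ≡ 1`.
[cite: MoeglinWaldspurger1995, IV.3.12] [cite: BernsteinLapid2019, §4 p. 10] -/
theorem hbddPK_of_letters_cm_three
    (ν : Measure ↥(adelicUnipotent (↥(maximalRealSubfield L)) L (IsCMField.complexConj L) 3)) [ν.IsHaarMeasure]
    {𝓕 : Set ↥(adelicUnipotent (↥(maximalRealSubfield L)) L (IsCMField.complexConj L) 3)}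
    (h𝓕N : IsFundamentalDomain ↥(rationalUnipotent (↥(maximalRealSubfield L)) L (IsCMField.complexConj L) 3) 𝓕 ν)
    (Ec : ℂ → (quasiSplit (↥(maximalRealSubfield L)) L (IsCMField.complexConj L) 3).Adelic → ℂ) (P : Set ℂ) (hPcd : ∀ z₀ : ℂ, ∀ᶠ z in 𝓝[≠] z₀, z ∉ P)
    (hEcinv : ∀ z : ℂ, z ∉ P → ∀ (γ : (quasiSplit (↥(maximalRealSubfield L)) L (IsCMField.complexConj L) 3).arithmeticSubgroup) (x : (quasiSplit (↥(maximalRealSubfield L)) L (IsCMField.complexConj L) 3).Adelic),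
      Ec z ((γ : (quasiSplit (↥(maximalRealSubfield L)) L (IsCMField.complexConj L) 3).Adelic) * x) = Ec z x)
    (hSM : ∀ z₀ ∈ P, 1 < z₀.re → ∃ (h : (quasiSplit (↥(maximalRealSubfield L)) L (IsCMField.complexConj L) 3).Adelic → ℝ) (s : ℂ → ℂ),
      Continuous h ∧ HasCompactSupport h ∧ ContinuousAt s z₀ ∧ s z₀ ≠ 0 ∧
        ∀ z : ℂ, z ∉ P → ∀ g : (quasiSplit (↥(maximalRealSubfield L)) L (IsCMField.complexConj L) 3).Adelic, ∫ y, ((h y : ℝ) : ℂ) * Ec z (g * y) ∂νG = s z * Ec z g)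
    (hL2 : ∀ z : ℂ, z ∉ P → ∀ T : ℝ≥0, 1 ≤ T → MemLp ((quasiSplit (↥(maximalRealSubfield L)) L (IsCMField.complexConj L) 3).quotFun (truncation ν 𝓕 T (Ec z))) 2 μ)
    (hMSP : ∀ z₀ ∈ P, 1 < z₀.re → z₀ ≠ (3 : ℂ) / 2 → ∀ T : ℝ≥0, 1 ≤ T →
      ∃ C : ℝ, ∀ᶠ z in 𝓝[≠] z₀, (eLpNorm ((quasiSplit (↥(maximalRealSubfield L)) L (IsCMField.complexConj L) 3).quotFun (truncation ν 𝓕 T (Ec z))) 2 μ).toReal ≤ C) :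
    ∀ z₀ ∈ P, 1 < z₀.re → z₀ ≠ (3 : ℂ) / 2 → ∀ K : Set (quasiSplit (↥(maximalRealSubfield L)) L (IsCMField.complexConj L) 3).Adelic, IsCompact K →
      ∃ C : ℝ, ∀ᶠ z in 𝓝[≠] z₀, ∀ g ∈ K, ‖Ec z g‖ ≤ C := by
  intro z₀ hz₀P hz₀ hz₀' K hK
  obtain ⟨h, s, hhc, hhs, hsc, hs0, hsm⟩ := hSM z₀ hz₀P hz₀
  obtain ⟨T₀, hT₀⟩ := eventually_forall_norm_mul_le_of_smoothing_eLpNorm_cm_three L μ νG ν h𝓕N hhc hhs hsc hs0 Ec (S := Pᶜ) (hPcd z₀)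
    (fun z hz => hEcinv z hz) (fun z hz => hsm z hz) (fun _ => (1 : ℂ)) hK
  obtain ⟨C, hC⟩ := hMSP z₀ hz₀P hz₀ hz₀' (max 1 T₀) (le_max_left _ _)
  obtain ⟨C', hC'⟩ := hT₀ (max 1 T₀) (le_max_right _ _) (fun z hz => hL2 z hz _ (le_max_left _ _))
    ⟨C, hC.mono fun z hz _ => by rw [norm_one, one_mul]; exact hz⟩
  exact ⟨C', hC'.mono fun z hz g hg => by simpa only [one_mul] using hz g hg⟩

/-- **(B-3∕2) OF LETTERS** — the ★ pole ledger's weighted letter `hbdd32` (★ p863972 :265) `∀ g, ∃ C, ∀ᶠ z in 𝓝[≠] (3∕2), ‖(z − 3∕2)·Ec z g‖ ≤ C`, PAID FROM: `hPcd`, `hEcinv` off `P`, the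
smoothing letter AT `3∕2` (`hSM32`), `hL2` (= (E6)), and THE analytic letter (MS-3∕2) `hMS32`: for every level `T ≥ 1` an eventual bound of `‖z − 3∕2‖·‖[Λ^T Ẽ(z)]‖_{L²(μ)}` near `3∕2`
(★ `msBound_middlePole_of_tube_letters` chain, read through §1's dictionary `‖z − 3∕2‖·(eLpNorm …).toReal = ‖(z − 3∕2)•Fam z‖`).  §2 with `a z := z − 3∕2` on `K := {g}`.
[cite: MoeglinWaldspurger1995, IV.1.11, IV.3.12] [cite: BernsteinLapid2019, §4 p. 10] -/
theorem hbdd32_of_letters_cm_three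
    (ν : Measure ↥(adelicUnipotent (↥(maximalRealSubfield L)) L (IsCMField.complexConj L) 3)) [ν.IsHaarMeasure]
    {𝓕 : Set ↥(adelicUnipotent (↥(maximalRealSubfield L)) L (IsCMField.complexConj L) 3)}
    (h𝓕N : IsFundamentalDomain ↥(rationalUnipotent (↥(maximalRealSubfield L)) L (IsCMField.complexConj L) 3) 𝓕 ν)
    (Ec : ℂ → (quasiSplit (↥(maximalRealSubfield L)) L (IsCMField.complexConj L) 3).Adelic → ℂ) (P : Set ℂ) (hPcd : ∀ z₀ : ℂ, ∀ᶠ z in 𝓝[≠] z₀, z ∉ P)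
    (hEcinv : ∀ z : ℂ, z ∉ P → ∀ (γ : (quasiSplit (↥(maximalRealSubfield L)) L (IsCMField.complexConj L) 3).arithmeticSubgroup) (x : (quasiSplit (↥(maximalRealSubfield L)) L (IsCMField.complexConj L) 3).Adelic),
      Ec z ((γ : (quasiSplit (↥(maximalRealSubfield L)) L (IsCMField.complexConj L) 3).Adelic) * x) = Ec z x)
    (hSM32 : ∃ (h : (quasiSplit (↥(maximalRealSubfield L)) L (IsCMField.complexConj L) 3).Adelic → ℝ) (s : ℂ → ℂ),
      Continuous h ∧ HasCompactSupport h ∧ ContinuousAt s ((3 : ℂ) / 2) ∧ s ((3 : ℂ) / 2) ≠ 0 ∧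
        ∀ z : ℂ, z ∉ P → ∀ g : (quasiSplit (↥(maximalRealSubfield L)) L (IsCMField.complexConj L) 3).Adelic, ∫ y, ((h y : ℝ) : ℂ) * Ec z (g * y) ∂νG = s z * Ec z g)
    (hL2 : ∀ z : ℂ, z ∉ P → ∀ T : ℝ≥0, 1 ≤ T → MemLp ((quasiSplit (↥(maximalRealSubfield L)) L (IsCMField.complexConj L) 3).quotFun (truncation ν 𝓕 T (Ec z))) 2 μ)
    (hMS32 : ∀ T : ℝ≥0, 1 ≤ T →
      ∃ C : ℝ, ∀ᶠ z in 𝓝[≠] ((3 : ℂ) / 2), ‖z - (3 : ℂ) / 2‖ * (eLpNorm ((quasiSplit (↥(maximalRealSubfield L)) L (IsCMField.complexConj L) 3).quotFun (truncation ν 𝓕 T (Ec z))) 2 μ).toReal ≤ C) :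
    ∀ g : (quasiSplit (↥(maximalRealSubfield L)) L (IsCMField.complexConj L) 3).Adelic, ∃ C : ℝ, ∀ᶠ z in 𝓝[≠] ((3 : ℂ) / 2), ‖(z - (3 : ℂ) / 2) * Ec z g‖ ≤ C := by
  intro g
  obtain ⟨h, s, hhc, hhs, hsc, hs0, hsm⟩ := hSM32
  obtain ⟨T₀, hT₀⟩ := eventually_forall_norm_mul_le_of_smoothing_eLpNorm_cm_three L μ νG ν h𝓕N hhc hhs hsc hs0 Ec (S := Pᶜ) (hPcd _)
    (fun z hz => hEcinv z hz) (fun z hz => hsm z hz) (fun z => z - (3 : ℂ) / 2) (isCompact_singleton (x := g))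
  obtain ⟨C, hC⟩ := hMS32 (max 1 T₀) (le_max_left _ _)
  obtain ⟨C', hC'⟩ := hT₀ (max 1 T₀) (le_max_right _ _) (fun z hz => hL2 z hz _ (le_max_left _ _)) ⟨C, hC.mono fun z hz _ => hz⟩
  exact ⟨C', hC'.mono fun z hz => hz g (mem_singleton g)⟩

/-- **(B-P-K) IN THE OPERATOR-ROAD CURRENCY** — the same with (MS-P′) stated through ANY `L²(μ)`-valued representatives: `hMSP′ : ∀ z₀ ∈ P, 1 < Re z₀ → z₀ ≠ 3∕2 → ∀ T ≥ 1, ∃ Fam : ℂ → L²(μ),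
(∀ z ∉ P, ⇑(Fam z) =ᵐ quotFun (Λ^T(Ec z))) ∧ ∃ C, ∀ᶠ z in 𝓝[≠] z₀, ‖Fam z‖ ≤ C` ((E6)'s family with its Maass–Selberg bound) — §1's dictionary converts to `eLpNorm`, and `hL2` is read
off the representatives. [cite: MoeglinWaldspurger1995, IV.3.12] [cite: BernsteinLapid2019, §4 p. 10] -/
theorem hbddPK_of_L2Family_letters_cm_three
    (ν : Measure ↥(adelicUnipotent (↥(maximalRealSubfield L)) L (IsCMField.complexConj L) 3)) [ν.IsHaarMeasure]
    {𝓕 : Set ↥(adelicUnipotent (↥(maximalRealSubfield L)) L (IsCMField.complexConj L) 3)}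
    (h𝓕N : IsFundamentalDomain ↥(rationalUnipotent (↥(maximalRealSubfield L)) L (IsCMField.complexConj L) 3) 𝓕 ν)
    (Ec : ℂ → (quasiSplit (↥(maximalRealSubfield L)) L (IsCMField.complexConj L) 3).Adelic → ℂ) (P : Set ℂ) (hPcd : ∀ z₀ : ℂ, ∀ᶠ z in 𝓝[≠] z₀, z ∉ P)
    (hEcinv : ∀ z : ℂ, z ∉ P → ∀ (γ : (quasiSplit (↥(maximalRealSubfield L)) L (IsCMField.complexConj L) 3).arithmeticSubgroup) (x : (quasiSplit (↥(maximalRealSubfield L)) L (IsCMField.complexConj L) 3).Adelic),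
      Ec z ((γ : (quasiSplit (↥(maximalRealSubfield L)) L (IsCMField.complexConj L) 3).Adelic) * x) = Ec z x)
    (hSM : ∀ z₀ ∈ P, 1 < z₀.re → ∃ (h : (quasiSplit (↥(maximalRealSubfield L)) L (IsCMField.complexConj L) 3).Adelic → ℝ) (s : ℂ → ℂ),
      Continuous h ∧ HasCompactSupport h ∧ ContinuousAt s z₀ ∧ s z₀ ≠ 0 ∧
        ∀ z : ℂ, z ∉ P → ∀ g : (quasiSplit (↥(maximalRealSubfield L)) L (IsCMField.complexConj L) 3).Adelic, ∫ y, ((h y : ℝ) : ℂ) * Ec z (g * y) ∂νG = s z * Ec z g)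
    (hE6 : ∀ T : ℝ≥0, 1 ≤ T → ∃ Fam : ℂ → (quasiSplit (↥(maximalRealSubfield L)) L (IsCMField.complexConj L) 3).L2 μ,
      ∀ z : ℂ, z ∉ P → ((Fam z : (quasiSplit (↥(maximalRealSubfield L)) L (IsCMField.complexConj L) 3).L2 μ) : (quasiSplit (↥(maximalRealSubfield L)) L (IsCMField.complexConj L) 3).automorphicQuotient → ℂ) =ᵐ[μ]
        (quasiSplit (↥(maximalRealSubfield L)) L (IsCMField.complexConj L) 3).quotFun (truncation ν 𝓕 T (Ec z)))
    (hMSP' : ∀ z₀ ∈ P, 1 < z₀.re → z₀ ≠ (3 : ℂ) / 2 → ∀ T : ℝ≥0, 1 ≤ T →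
      ∃ Fam : ℂ → (quasiSplit (↥(maximalRealSubfield L)) L (IsCMField.complexConj L) 3).L2 μ,
        (∀ z : ℂ, z ∉ P → ((Fam z : (quasiSplit (↥(maximalRealSubfield L)) L (IsCMField.complexConj L) 3).L2 μ) : (quasiSplit (↥(maximalRealSubfield L)) L (IsCMField.complexConj L) 3).automorphicQuotient → ℂ) =ᵐ[μ]
          (quasiSplit (↥(maximalRealSubfield L)) L (IsCMField.complexConj L) 3).quotFun (truncation ν 𝓕 T (Ec z))) ∧
        ∃ C : ℝ, ∀ᶠ z in 𝓝[≠] z₀, ‖Fam z‖ ≤ C) :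
    ∀ z₀ ∈ P, 1 < z₀.re → z₀ ≠ (3 : ℂ) / 2 → ∀ K : Set (quasiSplit (↥(maximalRealSubfield L)) L (IsCMField.complexConj L) 3).Adelic, IsCompact K →
      ∃ C : ℝ, ∀ᶠ z in 𝓝[≠] z₀, ∀ g ∈ K, ‖Ec z g‖ ≤ C := by
  refine hbddPK_of_letters_cm_three L μ νG ν h𝓕N Ec P hPcd hEcinv hSM (fun z hz T hT => ?_) (fun z₀ hz₀P hz₀ hz₀' T hT => ?_)
  · obtain ⟨Fam, hFam⟩ := hE6 T hT
    exact (Lp.memLp (Fam z)).ae_eq (hFam z hz)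
  · obtain ⟨Fam, hFam, C, hC⟩ := hMSP' z₀ hz₀P hz₀ hz₀' T hT
    refine ⟨C, ?_⟩
    filter_upwards [hC, hPcd z₀] with z hz hzP
    rwa [eLpNorm_toReal_eq_norm_of_ae_eq (hFam z hzP)]

end Ledger

end Summit.HodgeConjecture.HodgeConjecture.Cruxes.H413.K2E1ChiEisensteinJointBoundOfL2FamilyCMThree

end
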